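import Literature.Probability.FitznerVanDerHofstad2017.NobleBoundsN1IotaCls22
import Literature.Probability.FitznerVanDerHofstad2017.NobleJointTwoLevelIotaKitB1
import HarnessLib

/-!
# Fitzner–van der Hofstad (2017), §6.1: the class `(a,b) = (2,1)` of (6.4) at `N = 1` for the `ι`-event

[FvdH17] = R. Fitzner, R. van der Hofstad, *Mean-field behavior for nearest-neighbor percolation in `d > 10`*,
Electron. J. Probab. **22** (2017), no. 43, arXiv:1506.07977v2; §6.1 proof of Lemma 5.3 (pp. 58–59):
"Case `a ≥ 2`" of the `Ξ^ι` start, "`b = 1`: … `z` and `t` are connected by one direct bond … the factor `p⁻¹`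
includes the information that `z` and `t` are neighbors"; App. B rows `b ≥ 2` of `P^{ι,b}` (p. 73),
`Ā^{ι,2,1} = p⁻¹ S_{1̲,0,1̲,0}(e_ι, t−u, z−u, w−u)` (pp. 75, 78), `P^{E,1} = T_{1,1̲,1}` (p. 73).

The class estimate `h2 (2,1)` of `NobleBoundsN1IotaReduce.tsum_ofReal_nobleXiIotaN_one_le_of_cls₁₂` for the event
`E ι x = NobleJointTwoLevelIota.jointWitIota ι x`:
`J(v−u) ℙ_p^{⊗2}(jointWitIota ∩ class (2,1)) ≤ Σ_κ 𝟙{v = u+e_κ} P^{ι,2}(u,w) Ā'^{κ,2,1}(u,w,t,z) P^{E,1}(t−x,z−x)`.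
DOUBLY absorbed style (`NobleJointTwoLevelIotaKitB1`, after `NobleBoundsN1Cls21` for the plain joint event): the
pivotal bond `b₀ = (u,v)` and the bond `(t,z)` are absorbed on level `0` (lines `{u ←1̲→ v}₀`, `{t ←1̲→ z}₀` of
`S_{1̲,0,1̲,0}`, the second compensated by the `p⁻¹`), the level-`1` witnesses are re-routed onto the open bond
`(t,z)` (line `{t ←1̲→ z}₁` of `P^{E,1}`).  The level-`0` treatment of class `a = 2` (the bond `(u,w)` is closed
on level `0`, so the witness of `{u↔w}` resp. `{w↔e_ι}` has length `≥ 2`; for `u = e_ι` only part `II` is live,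
start `P^{ι,2}(e_ι,w)` — rows `two_base_zero` / `two_base_ne`; for `u ≠ e_ι` both parts are live and are bounded
by the two summands of `P^{ι,2}(u,w)` — `NobleJointTwoLevelIotaKit` §F) is that of the class `(2,0)`
(`NobleBoundsN1IotaCls20`).  An off-lattice bond `(t,z)` gives a null class.  Unconditional, every `d` and `p`.
-/

namespace Literature.Probability.FitznerVanDerHofstad2017

open Literature.Barriers.CriticalPhenomena Literature.Probability.Percolation Literature.Probability.LatticeModels
open Literature.Combinatorics.SimpleGraph _root_.SimpleGraph _root_.MeasureTheory
open Literature.Probability.FitznerVanDerHofstad2017.NobleBlocks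
open Literature.Probability.FitznerVanDerHofstad2017.NobleBlocks.LenIdx
open scoped ENNReal BigOperators

variable {d : ℕ}

namespace IotaCls21

/-! ### The level-`0` upgraded line families of class `a = 2` -/

/-- Part `II`, `u = e`, `w = 0`: `{0↔0}, {0 ←3→ e}, {e↔e}, {e↔e}, {z↔0}`. [cite: FitznerVanDerHofstad2017, §6.1 Case a ≥ 2 (arXiv:1506.07977v2 p. 59)] -/
def l0B0 (e z : Site d) : Fin 5 → Set (BondConfig (Site d)) :=
  ![event (ge 0) 0 0, event (ge 3) 0 e, event (ge 0) e e, event (ge 0) e e, event (ge 0) z 0]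

/-- Part `II`, `u = e`, `w ≠ 0`: `{0 ←1→ w}, {w ←2→ e}, {e↔e}, {e↔e}, {z↔w}`. [cite: FitznerVanDerHofstad2017, §6.1 Case a ≥ 2 (arXiv:1506.07977v2 p. 59)] -/
def l0Bw (e w z : Site d) : Fin 5 → Set (BondConfig (Site d)) :=
  ![event (ge 1) 0 w, event (ge 2) w e, event (ge 0) e e, event (ge 0) e e, event (ge 0) z w]

/-- Part `I`, `u ≠ e`, `w ≠ e`: `{0 ←3→ e}, {w ←1→ e}, {u ←2→ w}, {z↔w}, {e ←1→ u}`. [cite: FitznerVanDerHofstad2017, §6.1 Case a ≥ 2 (arXiv:1506.07977v2 p. 59)] -/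
def l0Iw (e u w z : Site d) : Fin 5 → Set (BondConfig (Site d)) :=
  ![event (ge 3) 0 e, event (ge 1) w e, event (ge 2) u w, event (ge 0) z w, event (ge 1) e u]

/-- Part `I`, `u ≠ e`, `w = e`: `{0 ←3→ e}, {e↔e}, {e ←2→ u}, {z↔e}, {e ←2→ u}`. [cite: FitznerVanDerHofstad2017, §6.1 Case a ≥ 2 (arXiv:1506.07977v2 p. 59)] -/
def l0Ie (e u z : Site d) : Fin 5 → Set (BondConfig (Site d)) :=
  ![event (ge 3) 0 e, event (ge 0) e e, event (ge 2) e u, event (ge 0) z e, event (ge 2) e u]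

/-- Part `II`, `u ≠ e`, `w = 0`: `{0↔0}, {0 ←3→ e}, {e↔u}, {e↔u}, {z↔0}`. [cite: FitznerVanDerHofstad2017, §6.1 Case a ≥ 2 (arXiv:1506.07977v2 p. 59)] -/
def l0F0 (e u z : Site d) : Fin 5 → Set (BondConfig (Site d)) :=
  ![event (ge 0) 0 0, event (ge 3) 0 e, event (ge 0) e u, event (ge 0) e u, event (ge 0) z 0]

/-- Part `II`, `u ≠ e`, `w ≠ 0`: `{0 ←1→ w}, {w ←1→ e}, {e↔u}, {e↔u}, {z↔w}`. [cite: FitznerVanDerHofstad2017, §6.1 Case a ≥ 2 (arXiv:1506.07977v2 p. 59)] -/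
def l0Fw (e u w z : Site d) : Fin 5 → Set (BondConfig (Site d)) :=
  ![event (ge 1) 0 w, event (ge 1) w e, event (ge 0) e u, event (ge 0) e u, event (ge 0) z w]

/-- [cite: FitznerVanDerHofstad2017, §4.2 Def. 4.1 (arXiv:1506.07977v2 p. 35)] -/
theorem isFinitary_l0B0 (e z : Site d) : ∀ i, IsFinitary (l0B0 (d := d) e z i) := by
  intro i; fin_cases i
  exacts [isFinitary_event (ge 0) 0 0, isFinitary_event (ge 3) 0 e, isFinitary_event (ge 0) e e,
    isFinitary_event (ge 0) e e, isFinitary_event (ge 0) z 0]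

/-- [cite: FitznerVanDerHofstad2017, §4.2 Def. 4.1 (arXiv:1506.07977v2 p. 35)] -/
theorem isFinitary_l0Bw (e w z : Site d) : ∀ i, IsFinitary (l0Bw (d := d) e w z i) := by
  intro i; fin_cases i
  exacts [isFinitary_event (ge 1) 0 w, isFinitary_event (ge 2) w e, isFinitary_event (ge 0) e e,
    isFinitary_event (ge 0) e e, isFinitary_event (ge 0) z w]

/-- [cite: FitznerVanDerHofstad2017, §4.2 Def. 4.1 (arXiv:1506.07977v2 p. 35)] -/
theorem isFinitary_l0Iw (e u w z : Site d) : ∀ i, IsFinitary (l0Iw (d := d) e u w z i) := by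
  intro i; fin_cases i
  exacts [isFinitary_event (ge 3) 0 e, isFinitary_event (ge 1) w e, isFinitary_event (ge 2) u w,
    isFinitary_event (ge 0) z w, isFinitary_event (ge 1) e u]

/-- [cite: FitznerVanDerHofstad2017, §4.2 Def. 4.1 (arXiv:1506.07977v2 p. 35)] -/
theorem isFinitary_l0Ie (e u z : Site d) : ∀ i, IsFinitary (l0Ie (d := d) e u z i) := by
  intro i; fin_cases i
  exacts [isFinitary_event (ge 3) 0 e, isFinitary_event (ge 0) e e, isFinitary_event (ge 2) e u,
    isFinitary_event (ge 0) z e, isFinitary_event (ge 2) e u]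

/-- [cite: FitznerVanDerHofstad2017, §4.2 Def. 4.1 (arXiv:1506.07977v2 p. 35)] -/
theorem isFinitary_l0F0 (e u z : Site d) : ∀ i, IsFinitary (l0F0 (d := d) e u z i) := by
  intro i; fin_cases i
  exacts [isFinitary_event (ge 0) 0 0, isFinitary_event (ge 3) 0 e, isFinitary_event (ge 0) e u,
    isFinitary_event (ge 0) e u, isFinitary_event (ge 0) z 0]

/-- [cite: FitznerVanDerHofstad2017, §4.2 Def. 4.1 (arXiv:1506.07977v2 p. 35)] -/
theorem isFinitary_l0Fw (e u w z : Site d) : ∀ i, IsFinitary (l0Fw (d := d) e u w z i) := by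
  intro i; fin_cases i
  exacts [isFinitary_event (ge 1) 0 w, isFinitary_event (ge 1) w e, isFinitary_event (ge 0) e u,
    isFinitary_event (ge 0) e u, isFinitary_event (ge 0) z w]

/-! ### Facts of the class -/

/-- On `jointWitIota ∩ class (2,1)`: the side conditions, the closed bond `(u,w)` on level `0` (`u ≠ w`), the open
bond `(t,z)` on level `1` (`t ≠ z`), and `z, t ≠ x`.
[cite: FitznerVanDerHofstad2017, §6.1 "Case a = 2", "b = 1" (arXiv:1506.07977v2 pp. 58–59)] -/
theorem facts {ι : Fin d × Bool} {x u v w z t : Site d} {ω : Fin 2 → BondConfig (Site d)}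
    (hω : ω ∈ jointWitIota ι x u v w z t ∩ clsSet u w t z 2 1) :
    JWιSide u v w z t x ∧ (u ≠ w ∧ s(u, w) ∉ ω 0) ∧ (t ≠ z ∧ s(t, z) ∈ ω 1) ∧ z ≠ x ∧ t ≠ x := by
  have hs : JWιSide u v w z t x := by
    rcases hω.1 with h | h
    exacts [h.1, h.1]
  exact ⟨hs, (mem_lineCls_two_iff u w 0 ω).1 hω.2.1, (mem_lineCls_one_iff t z 1 ω).1 hω.2.2,
    ne_and_ne_of_side_of_mem_lineCls hs (by decide) hω.2.2⟩

/-- The row `Ā'^{κ,2,1}(u,w,t,z) = p⁻¹ S_{1̲,0,1̲,0}(v−u, t−u, z−u, w−u)` for `v = u + e_κ`.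
[cite: FitznerVanDerHofstad2017, App. B `Ā^{ι,2,1}` (arXiv:1506.07977v2 pp. 75, 78)] -/
theorem blockAbar'_eq (p : unitInterval) {u v : Site d} {κ : Fin d × Bool} (hv : v = u + stepVec κ) (w t z : Site d) :
    blockAbar' (Letters.perc d p) κ 2 1 u w t z = (ENNReal.ofReal p)⁻¹ *
      (Letters.perc d p).S (eq 1) (ge 0) (eq 1) (ge 0) (v - u) (t - u) (z - u) (w - u) := by
  rw [Cls21.blockAbar'_two_one, hv, add_sub_cancel_left]; rfl

end IotaCls21

open IotaCls21
open IotaCls22 (notMem_of_subset)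

section

variable (p : unitInterval)

/-- **Class `(2,1)`, `u = e_ι`**: only part `II` is live; start `P^{ι,2}(e_ι,w)`.
[cite: FitznerVanDerHofstad2017, §6.1 proof of Lemma 5.3, Case a ≥ 2 with `u = e_ι`, "b = 1" (arXiv:1506.07977v2 p. 59); App. B `Ā^{ι,2,1}` (pp. 75, 78)] -/
theorem jointWitIota_cls_two_one_of_eq {ι : Fin d × Bool} {u : Site d} (hu : u = stepVec ι) (x v w z t : Site d) :
    ENNReal.ofReal (bondJ d p (v - u)) * piPerc d p 2 (jointWitIota ι x u v w z t ∩ clsSet u w t z 2 1) ≤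
      ∑ κ : Fin d × Bool, (if v = u + stepVec κ then (1 : ℝ≥0∞) else 0) *
        (blockPiota (Letters.perc d p) ι 2 u w * blockAbar' (Letters.perc d p) κ 2 1 u w t z *
          blockPE (Letters.perc d p) 1 (t - x) (z - x)) := by
  classical
  refine ofReal_bondJ_mul_le_sum_ite p u v _ _ fun κ hv => ?_
  by_cases hne : (jointWitIota ι x u v w z t ∩ clsSet u w t z 2 1).Nonempty
  swap
  · rw [Set.not_nonempty_iff_eq_empty.1 hne, measure_empty, mul_zero]; exact zero_le
  obtain ⟨ω₀, hω₀⟩ := hne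
  obtain ⟨hs, -, ⟨htz, -⟩, hzx, htx⟩ := facts hω₀
  have huv : u ≠ v := (adj_of_eq_add_stepVec hv).ne
  have htu : t ≠ u := hs.2.2.2.2.1
  have hzu : z ≠ u := hs.2.2.2.2.2.1
  rw [jointWitIota_inter_eq_of_I (jointWitIotaI_inter_clsSet_eq_empty_of_eq hu x v w z t (a := 2) (by decide) 1)]
  subst hu
  -- the bond `(t,z)` must be a lattice bond
  by_cases hadjt : (zdGraph d).Adj t z
  swap
  · rw [piPerc_eq_zero_of_not_adj₁ p (fun ω hω => ((mem_lineCls_one_iff t z 1 ω).1 hω.2.2).2) hadjt, mul_zero]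
    exact zero_le
  rw [blockAbar'_eq p hv]
  refine ofReal_mul_le_of_absorb_two ?_
  have hB : MeasurableSet (jointWitIotaII ι x (stepVec ι) v w z t ∩ clsSet (stepVec ι) w t z 2 1) :=
    (measurableSet_jointWitIotaII ι x (stepVec ι) v w z t).inter (measurableSet_clsSet (stepVec ι) w t z 2 1)
  rw [ofReal_mul_piPerc_eq_inter_of_preimage p hv hB
      (eraseAt0_preimage_jointWitIotaII_inter_clsSet ι x (stepVec ι) v w z t 2 1),
    ofReal_mul_piPerc_eq_inter_tz p hadjt hB (eraseAt0_tz_preimage_jointWitIotaII_inter_cls₁ ι x (stepVec ι) v w z t 2)]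
  have hE : ∀ ω ∈ jointWitIotaII ι x (stepVec ι) v w z t,
      JointWitnessedι (jwιLinesII (stepVec ι) (stepVec ι) w z) ∅ s((0 : Site d), stepVec ι) z v t x
        (offBonds {s(stepVec ι, v)} (ω 0)) (offBonds (bondsAt {stepVec ι}) (ω 1)) := fun ω hω => hω.2.2.2.2.2
  by_cases hw0 : w = 0
  · subst hw0
    have h3 := piPerc_inter_le_prod₃_of_witnessedι₀₁ p (C := clsSet (stepVec ι) 0 t z 2 1) hE IotaB1.cls₁_facts
      htu hzu (IotaB1.mk (l0B0 (stepVec ι) z) (stepVec ι) v t z x) (IotaB1.isFinitary_mk (isFinitary_l0B0 _ z) _ v t z x)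
      grpιII₀₁ grpιII₀₁_adm
      (fun ω hω hlat i K hK _ hL hI _ => by
        fin_cases i
        · exact mem_openConnGe_zero_of_mem hL
        · exact mem_event_ge_three_zero_stepVec hlat hK hL (hI (Finset.notMem_empty _))
        · exact mem_openConnGe_zero_of_mem hL
        · exact mem_openConnGe_zero_of_mem hL
        · have hL' : K ∈ (openConn (0 : Site d) z : Set (BondConfig (Site d))) := hL
          exact mem_openConnGe_zero_of_mem (SimpleGraph.Reachable.symm hL'))
      (mem_openConnEq_one_of_mem huv (Set.mem_singleton _)) (mem_openConnEq_one_of_mem htz (Set.mem_singleton _))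
      (IotaB1.up₁ hzx htx)
    refine h3.trans (mul_le_mul' (mul_le_mul' ?_ ?_) ?_)
    · exact piPerc_grp_le _ _ _ 0 ![Sum.inl (Sum.inl 1)] (by decide) (by decide) (by funext m; fin_cases m; rfl)
        (piPerc_iotaStart_two_base_zero_le_blockPiota p ι _)
    · exact piPerc_grp_le _ _ _ 1 ![Sum.inl (Sum.inr 0), Sum.inr 0, Sum.inl (Sum.inr 1), Sum.inl (Sum.inl 4)]
        (by decide) (by decide) (by funext m; fin_cases m <;> rfl) (piPerc_mid_b1_le_S p (stepVec ι) v t z 0 _)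
    · exact piPerc_grp_le _ _ _ 2 ![Sum.inr 2, Sum.inr 1, Sum.inr 3] (by decide) (by decide)
        (by funext m; fin_cases m <;> rfl) (piPerc_end_one_le_blockPE p htx hzx _)
  · have h3 := piPerc_inter_le_prod₃_of_witnessedι₀₁ p (C := clsSet (stepVec ι) w t z 2 1) hE IotaB1.cls₁_facts
      htu hzu (IotaB1.mk (l0Bw (stepVec ι) w z) (stepVec ι) v t z x)
      (IotaB1.isFinitary_mk (isFinitary_l0Bw _ w z) _ v t z x) grpιII₀₁ grpιII₀₁_adm
      (fun ω hω hlat i K hK _ hL hI _ => by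
        have hwe : w ≠ stepVec ι := (sideII_of_mem hω.1).2.1
        have hcl := notMem_of_subset hK ((mem_lineCls_two_iff (stepVec ι) w 0 ω).1 hω.2.1).2
        fin_cases i
        · exact mem_openConnGe_one_of_ne hL (Ne.symm hw0)
        · exact mem_openConnGe_two_of_notMem hL hwe hcl.2
        · exact mem_openConnGe_zero_of_mem hL
        · exact mem_openConnGe_zero_of_mem hL
        · have hL' : K ∈ (openConn w z : Set (BondConfig (Site d))) := hL
          exact mem_openConnGe_zero_of_mem (SimpleGraph.Reachable.symm hL'))
      (mem_openConnEq_one_of_mem huv (Set.mem_singleton _)) (mem_openConnEq_one_of_mem htz (Set.mem_singleton _))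
      (IotaB1.up₁ hzx htx)
    refine h3.trans (mul_le_mul' (mul_le_mul' ?_ ?_) ?_)
    · exact piPerc_grp_le _ _ _ 0 ![Sum.inl (Sum.inl 0), Sum.inl (Sum.inl 1)] (by decide) (by decide)
        (by funext m; fin_cases m <;> rfl) (piPerc_iotaStart_two_base_ne_le_blockPiota p ι w _)
    · exact piPerc_grp_le _ _ _ 1 ![Sum.inl (Sum.inr 0), Sum.inr 0, Sum.inl (Sum.inr 1), Sum.inl (Sum.inl 4)]
        (by decide) (by decide) (by funext m; fin_cases m <;> rfl) (piPerc_mid_b1_le_S p (stepVec ι) v t z w _)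
    · exact piPerc_grp_le _ _ _ 2 ![Sum.inr 2, Sum.inr 1, Sum.inr 3] (by decide) (by decide)
        (by funext m; fin_cases m <;> rfl) (piPerc_end_one_le_blockPE p htx hzx _)

/-- **Class `(2,1)`, `u ≠ e_ι`**: both parts are live, bounded by the two summands of `P^{ι,2}(u,w)`.
[cite: FitznerVanDerHofstad2017, §6.1 proof of Lemma 5.3, Case a ≥ 2 with `u ≠ e_ι`, "b = 1"; (4.69); App. B rows b ≥ 2 of P^{ι,b}, `Ā^{ι,2,1}` (arXiv:1506.07977v2 pp. 44, 59, 73, 75, 78)] -/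
theorem jointWitIota_cls_two_one_of_ne {ι : Fin d × Bool} {u : Site d} (hu : u ≠ stepVec ι) (x v w z t : Site d) :
    ENNReal.ofReal (bondJ d p (v - u)) * piPerc d p 2 (jointWitIota ι x u v w z t ∩ clsSet u w t z 2 1) ≤
      ∑ κ : Fin d × Bool, (if v = u + stepVec κ then (1 : ℝ≥0∞) else 0) *
        (blockPiota (Letters.perc d p) ι 2 u w * blockAbar' (Letters.perc d p) κ 2 1 u w t z *
          blockPE (Letters.perc d p) 1 (t - x) (z - x)) := by
  classical
  refine ofReal_bondJ_mul_le_sum_ite p u v _ _ fun κ hv => ?_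
  by_cases hne : (jointWitIota ι x u v w z t ∩ clsSet u w t z 2 1).Nonempty
  swap
  · rw [Set.not_nonempty_iff_eq_empty.1 hne, measure_empty, mul_zero]; exact zero_le
  obtain ⟨ω₀, hω₀⟩ := hne
  obtain ⟨hs, ⟨huw, -⟩, ⟨htz, -⟩, hzx, htx⟩ := facts hω₀
  have huv : u ≠ v := (adj_of_eq_add_stepVec hv).ne
  have htu : t ≠ u := hs.2.2.2.2.1
  have hzu : z ≠ u := hs.2.2.2.2.2.1
  -- the bond `(t,z)` must be a lattice bond
  by_cases hadjt : (zdGraph d).Adj t z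
  swap
  · rw [piPerc_eq_zero_of_not_adj₁ p (fun ω hω => ((mem_lineCls_one_iff t z 1 ω).1 hω.2.2).2) hadjt, mul_zero]
    exact zero_le
  rw [blockAbar'_eq p hv]
  refine mul_le_blocks_of_parts (piPerc_jointWitIota_inter_le_add p ι x u v w z t _) ?_ ?_
    (summands_le_blockPiota_two (Letters.perc d p) ι u w)
  · -- part `I`
    refine ofReal_mul_le_of_absorb_two ?_
    have hB : MeasurableSet (jointWitIotaI ι x u v w z t ∩ clsSet u w t z 2 1) :=
      (measurableSet_jointWitIotaI ι x u v w z t).inter (measurableSet_clsSet u w t z 2 1)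
    rw [ofReal_mul_piPerc_eq_inter_of_preimage p hv hB (eraseAt0_preimage_jointWitIotaI_inter_clsSet ι x u v w z t 2 1),
      ofReal_mul_piPerc_eq_inter_tz p hadjt hB (eraseAt0_tz_preimage_jointWitIotaI_inter_cls₁ ι x u v w z t 2)]
    have hE : ∀ ω ∈ jointWitIotaI ι x u v w z t,
        JointWitnessedι (jwιLinesI (stepVec ι) u w z) {3} s((0 : Site d), stepVec ι) z v t x
          (offBonds {s(u, v)} (ω 0)) (offBonds (bondsAt {u}) (ω 1)) := fun ω hω => hω.2.2
    by_cases hw : w = stepVec ι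
    · subst hw
      have h3 := piPerc_inter_le_prod₃_of_witnessedι₀₁ p (C := clsSet u (stepVec ι) t z 2 1) hE
        IotaB1.cls₁_facts htu hzu (IotaB1.mk (l0Ie (stepVec ι) u z) u v t z x)
        (IotaB1.isFinitary_mk (isFinitary_l0Ie _ u z) u v t z x) grpιI₀₁ grpιI₀₁_adm
        (fun ω hω hlat i K hK _ hL hI _ => by
          have hcl := notMem_of_subset hK ((mem_lineCls_two_iff u (stepVec ι) 0 ω).1 hω.2.1).2
          fin_cases i
          · exact mem_event_ge_three_zero_stepVec hlat hK hL (hI (by decide))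
          · exact mem_openConnGe_zero_of_mem hL
          · exact mem_openConnGe_two_of_notMem hL (Ne.symm hu) hcl.2
          · have hL' : K ∈ (openConn (stepVec ι) z : Set (BondConfig (Site d))) := hL
            exact mem_openConnGe_zero_of_mem (SimpleGraph.Reachable.symm hL')
          · exact mem_openConnGe_two_of_notMem hL (Ne.symm hu) hcl.2)
        (mem_openConnEq_one_of_mem huv (Set.mem_singleton _)) (mem_openConnEq_one_of_mem htz (Set.mem_singleton _))
        (IotaB1.up₁ hzx htx)
      refine h3.trans (mul_le_mul' (mul_le_mul' ?_ ?_) ?_)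
      · exact piPerc_grp_le _ _ _ 0 ![Sum.inl (Sum.inl 0), Sum.inl (Sum.inl 2), Sum.inl (Sum.inl 4)] (by decide)
          (by decide) (by funext m; fin_cases m <;> rfl) (piPerc_iotaStartI_two_ne_eq_le p ι hu _ rfl)
      · exact piPerc_grp_le _ _ _ 1 ![Sum.inl (Sum.inr 0), Sum.inr 0, Sum.inl (Sum.inr 1), Sum.inl (Sum.inl 3)]
          (by decide) (by decide) (by funext m; fin_cases m <;> rfl) (piPerc_mid_b1_le_S p u v t z (stepVec ι) _)
      · exact piPerc_grp_le _ _ _ 2 ![Sum.inr 2, Sum.inr 1, Sum.inr 3] (by decide) (by decide)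
          (by funext m; fin_cases m <;> rfl) (piPerc_end_one_le_blockPE p htx hzx _)
    · have h3 := piPerc_inter_le_prod₃_of_witnessedι₀₁ p (C := clsSet u w t z 2 1) hE IotaB1.cls₁_facts htu hzu
        (IotaB1.mk (l0Iw (stepVec ι) u w z) u v t z x) (IotaB1.isFinitary_mk (isFinitary_l0Iw _ u w z) u v t z x)
        grpιI₀₁ grpιI₀₁_adm
        (fun ω hω hlat i K hK _ hL hI _ => by
          have hcl := notMem_of_subset hK ((mem_lineCls_two_iff u w 0 ω).1 hω.2.1).2
          fin_cases i
          · exact mem_event_ge_three_zero_stepVec hlat hK hL (hI (by decide))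
          · have hL' : K ∈ (openConn (stepVec ι) w : Set (BondConfig (Site d))) := hL
            exact mem_openConnGe_one_of_ne (SimpleGraph.Reachable.symm hL') hw
          · have hL' : K ∈ (openConn w u : Set (BondConfig (Site d))) := hL
            exact mem_openConnGe_two_of_notMem (SimpleGraph.Reachable.symm hL') huw hcl.1
          · have hL' : K ∈ (openConn w z : Set (BondConfig (Site d))) := hL
            exact mem_openConnGe_zero_of_mem (SimpleGraph.Reachable.symm hL')
          · exact mem_openConnGe_one_of_ne hL (Ne.symm hu))
        (mem_openConnEq_one_of_mem huv (Set.mem_singleton _)) (mem_openConnEq_one_of_mem htz (Set.mem_singleton _))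
        (IotaB1.up₁ hzx htx)
      refine h3.trans (mul_le_mul' (mul_le_mul' ?_ ?_) ?_)
      · exact piPerc_grp_le _ _ _ 0
          ![Sum.inl (Sum.inl 0), Sum.inl (Sum.inl 4), Sum.inl (Sum.inl 2), Sum.inl (Sum.inl 1)] (by decide)
          (by decide) (by funext m; fin_cases m <;> rfl) (piPerc_iotaStartI_two_ne_ne_le p ι hu hw _)
      · exact piPerc_grp_le _ _ _ 1 ![Sum.inl (Sum.inr 0), Sum.inr 0, Sum.inl (Sum.inr 1), Sum.inl (Sum.inl 3)]
          (by decide) (by decide) (by funext m; fin_cases m <;> rfl) (piPerc_mid_b1_le_S p u v t z w _)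
      · exact piPerc_grp_le _ _ _ 2 ![Sum.inr 2, Sum.inr 1, Sum.inr 3] (by decide) (by decide)
          (by funext m; fin_cases m <;> rfl) (piPerc_end_one_le_blockPE p htx hzx _)
  · -- part `II`
    refine ofReal_mul_le_of_absorb_two ?_
    have hB : MeasurableSet (jointWitIotaII ι x u v w z t ∩ clsSet u w t z 2 1) :=
      (measurableSet_jointWitIotaII ι x u v w z t).inter (measurableSet_clsSet u w t z 2 1)
    rw [ofReal_mul_piPerc_eq_inter_of_preimage p hv hB (eraseAt0_preimage_jointWitIotaII_inter_clsSet ι x u v w z t 2 1),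
      ofReal_mul_piPerc_eq_inter_tz p hadjt hB (eraseAt0_tz_preimage_jointWitIotaII_inter_cls₁ ι x u v w z t 2)]
    have hE : ∀ ω ∈ jointWitIotaII ι x u v w z t,
        JointWitnessedι (jwιLinesII (stepVec ι) u w z) ∅ s((0 : Site d), stepVec ι) z v t x
          (offBonds {s(u, v)} (ω 0)) (offBonds (bondsAt {u}) (ω 1)) := fun ω hω => hω.2.2.2.2.2
    by_cases hw0 : w = 0
    · subst hw0
      have h3 := piPerc_inter_le_prod₃_of_witnessedι₀₁ p (C := clsSet u 0 t z 2 1) hE IotaB1.cls₁_facts htu hzu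
        (IotaB1.mk (l0F0 (stepVec ι) u z) u v t z x) (IotaB1.isFinitary_mk (isFinitary_l0F0 _ u z) u v t z x)
        grpιII₀₁ grpιII₀₁_adm
        (fun ω hω hlat i K hK _ hL hI _ => by
          fin_cases i
          · exact mem_openConnGe_zero_of_mem hL
          · exact mem_event_ge_three_zero_stepVec hlat hK hL (hI (Finset.notMem_empty _))
          · exact mem_openConnGe_zero_of_mem hL
          · exact mem_openConnGe_zero_of_mem hL
          · have hL' : K ∈ (openConn (0 : Site d) z : Set (BondConfig (Site d))) := hL
            exact mem_openConnGe_zero_of_mem (SimpleGraph.Reachable.symm hL'))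
        (mem_openConnEq_one_of_mem huv (Set.mem_singleton _)) (mem_openConnEq_one_of_mem htz (Set.mem_singleton _))
        (IotaB1.up₁ hzx htx)
      refine h3.trans (mul_le_mul' (mul_le_mul' ?_ ?_) ?_)
      · exact piPerc_grp_le _ _ _ 0 ![Sum.inl (Sum.inl 1), Sum.inl (Sum.inl 2), Sum.inl (Sum.inl 3)] (by decide)
          (by decide) (by funext m; fin_cases m <;> rfl) (piPerc_iotaStartII_two_far_zero_le p ι hu _ rfl)
      · exact piPerc_grp_le _ _ _ 1 ![Sum.inl (Sum.inr 0), Sum.inr 0, Sum.inl (Sum.inr 1), Sum.inl (Sum.inl 4)]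
          (by decide) (by decide) (by funext m; fin_cases m <;> rfl) (piPerc_mid_b1_le_S p u v t z 0 _)
      · exact piPerc_grp_le _ _ _ 2 ![Sum.inr 2, Sum.inr 1, Sum.inr 3] (by decide) (by decide)
          (by funext m; fin_cases m <;> rfl) (piPerc_end_one_le_blockPE p htx hzx _)
    · have h3 := piPerc_inter_le_prod₃_of_witnessedι₀₁ p (C := clsSet u w t z 2 1) hE IotaB1.cls₁_facts htu hzu
        (IotaB1.mk (l0Fw (stepVec ι) u w z) u v t z x) (IotaB1.isFinitary_mk (isFinitary_l0Fw _ u w z) u v t z x)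
        grpιII₀₁ grpιII₀₁_adm
        (fun ω hω hlat i K hK _ hL hI _ => by
          have hwe : w ≠ stepVec ι := (sideII_of_mem hω.1).2.1
          fin_cases i
          · exact mem_openConnGe_one_of_ne hL (Ne.symm hw0)
          · exact mem_openConnGe_one_of_ne hL hwe
          · exact mem_openConnGe_zero_of_mem hL
          · exact mem_openConnGe_zero_of_mem hL
          · have hL' : K ∈ (openConn w z : Set (BondConfig (Site d))) := hL
            exact mem_openConnGe_zero_of_mem (SimpleGraph.Reachable.symm hL'))
        (mem_openConnEq_one_of_mem huv (Set.mem_singleton _)) (mem_openConnEq_one_of_mem htz (Set.mem_singleton _))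
        (IotaB1.up₁ hzx htx)
      refine h3.trans (mul_le_mul' (mul_le_mul' ?_ ?_) ?_)
      · exact piPerc_grp_le _ _ _ 0
          ![Sum.inl (Sum.inl 0), Sum.inl (Sum.inl 1), Sum.inl (Sum.inl 2), Sum.inl (Sum.inl 3)] (by decide)
          (by decide) (by funext m; fin_cases m <;> rfl) (piPerc_iotaStartII_two_far_ne_le p ι hu w _ rfl)
      · exact piPerc_grp_le _ _ _ 1 ![Sum.inl (Sum.inr 0), Sum.inr 0, Sum.inl (Sum.inr 1), Sum.inl (Sum.inl 4)]
          (by decide) (by decide) (by funext m; fin_cases m <;> rfl) (piPerc_mid_b1_le_S p u v t z w _)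
      · exact piPerc_grp_le _ _ _ 2 ![Sum.inr 2, Sum.inr 1, Sum.inr 3] (by decide) (by decide)
          (by funext m; fin_cases m <;> rfl) (piPerc_end_one_le_blockPE p htx hzx _)

/-- **The class `(a,b) = (2,1)` of (6.4) at `N = 1` for the `ι`-event** — the cell `h2 (2,1)` of
`NobleBoundsN1IotaReduce.tsum_ofReal_nobleXiIotaN_one_le_of_cls₁₂` with `E ι x := jointWitIota ι x`.
[cite: FitznerVanDerHofstad2017, §6.1 proof of Lemma 5.3, (6.4) class (a,b) = (2,1) (arXiv:1506.07977v2 pp. 58–59)] -/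
theorem jointWitIota_cls_two_one (ι : Fin d × Bool) (x u v w z t : Site d) :
    ENNReal.ofReal (bondJ d p (v - u)) * piPerc d p 2 (jointWitIota ι x u v w z t ∩ clsSet u w t z 2 1) ≤
      ∑ κ : Fin d × Bool, (if v = u + stepVec κ then (1 : ℝ≥0∞) else 0) *
        (blockPiota (Letters.perc d p) ι 2 u w * blockAbar' (Letters.perc d p) κ 2 1 u w t z *
          blockPE (Letters.perc d p) 1 (t - x) (z - x)) := by
  by_cases hu : u = stepVec ι
  exacts [jointWitIota_cls_two_one_of_eq p hu x v w z t, jointWitIota_cls_two_one_of_ne p hu x v w z t]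

end

end Literature.Probability.FitznerVanDerHofstad2017
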